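import Literature.Analysis.FluidPDE.PlanarTypedChain
import HarnessLib

/-!
# Band pieces: charts, slabs and clips of the bands of typed elements, and the corner principle

Topic `Literature/Analysis/FluidPDE`. Level-4 data model, part 4 (after `PlanarTypedChain.lean`).
Every geometric side condition of a phase (order conditions, cover, gate geometry) is a statement
"on the part of the band of element `k` inside its support box, some affine lab functional is
`≤ 0` (or `< 0`)". This file reduces such statements to finitely many rational inequalities:

* **frame coordinates and charts.** For a typed element `e` (orientation `o`), `e.uOf z`, `e.vOf z`
  are its frame coordinates (a run: `(A z)₀, (A z)₁`; a diagonal band: `(u, v) = diagFrame (A z)`),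
  integer linear forms in `z`; `e.chart u v` is the inverse map, with rational coefficients
  `e.chartC i` (`chart_apply`, `chart_uOf_vOf`). The band of `e` is `|vOf z - line (α, uOf z)| ≤ R`
  with `line = y(α)` (run) or `T(α, ·)` (diagonal band) and `R = r₀ · Ξᵤ(α, u)` (tight band, `mem_bandT_iff`).
* **slabs.** On a `u`-interval in a definite REGIME of the profile (`RegQ`: `flat`, `gap m`,
  `trans m`; real-side validity `RegOK`, Boolean `regOKB`) the line lies in the slab
  `C(α) + W(α) u + [δlo, δhi]` with explicit `C, W` (`gapVal = C_m + W_m u`; on a transition piece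
  the add-ons come from the two-sided ramp bounds `rampLo ≤ rampAt ≤ rampHi`, `line_sub_mem`); so
  a band point with `u` in the piece is `e.chart u (C + W u + w)` with `w ∈ [δlo - R, δhi + R]`.
* **the corner principle.** An affine lab functional `φ` (`LinFun`: `f₀ z₀ + f₁ z₁ + g(α)`) composed
  with the chart is affine in `(u, w)`, hence `≤ 0` (`< 0`) on a piece as soon as it is so at the
  four corners (`le_on_rect`, `lt_on_rect`); the corner values are rational clock-affine data when
  one factor of each product is constant (`Aff.mulO`, `cornerValO`), and `LinFun.le_on_piece` /
  `lt_on_piece` turn four Boolean endpoint checks into the inequality on the whole piece for every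
  clock value in `[0,1]`.
* **clips and coverage.** `clipOKB` certifies that the band leaves the support box below `uIn`
  and above `uOut` (an exact regime there, both slab extremes beyond one support edge at the clip,
  and the edge functional monotone in `u`), `coverB` that the pieces cover `[uIn, uOut]` with valid
  regimes; `exists_piece` concludes: every band point in the support box lies in some piece, in
  chart form with `w` in the piece's slab.

Folklore (elementary affine geometry); no named facts. Infrastructure towards a discharge of
`acm_compatible_blocks` (`QuasiSelfSimilarCompatibleBlocks.lean`).

## References

* G. Alberti, G. Crippa, A. L. Mazzucato, *Exponential self-similar mixing by incompressible
  flows*, J. Amer. Math. Soc. 32 (2019), 445–490, §§7–8 (arXiv:1605.02090).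
-/

noncomputable section

open Function Set Filter
open scoped Topology ContDiff

namespace Literature.Analysis.FluidPDE

namespace PlanarKinematics

open Gluing

/-- The plane `ℝ²` as a Euclidean space. [folklore] -/
local notation "E²" => EuclideanSpace ℝ (Fin 2)

/-! ## Products of clock-affine data under the constancy rule -/

namespace Aff

/-- Boolean test: the datum is constant. [folklore] -/
def isConstB (a : Aff) : Bool := decide (a.v0 = a.v1)

/-- A constant datum evaluates to its value. [folklore] -/
theorem eval_of_isConstB {a : Aff} (h : a.isConstB = true) (α : ℝ) : a.eval α = a.v0 := by
  simp only [isConstB, decide_eq_true_eq] at h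
  rw [eval_apply, h]; ring

/-- **Product under the constancy rule**: defined when one factor is constant. [folklore] -/
def mulO (a b : Aff) : Option Aff :=
  if a.isConstB then some (smul a.v0 b) else if b.isConstB then some (smul b.v0 a) else none

/-- **Soundness of the product.** [folklore] -/
theorem eval_of_mulO {a b c : Aff} (h : mulO a b = some c) (α : ℝ) : c.eval α = a.eval α * b.eval α := by
  unfold mulO at h
  split_ifs at h with ha hb
  · cases h; rw [eval_smul, eval_of_isConstB ha]
  · cases h; rw [eval_smul, eval_of_isConstB hb]; ring

/-- Sum of an optional datum and a datum. [folklore] -/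
def addO (a : Option Aff) (b : Aff) : Option Aff := a.map fun x => x.add b

/-- Soundness of the optional sum. [folklore] -/
theorem eval_of_addO {a : Option Aff} {b c : Aff} (h : addO a b = some c) {x : ℝ} {α : ℝ}
    (ha : ∀ a', a = some a' → a'.eval α = x) : c.eval α = x + b.eval α := by
  cases a with
  | none => simp [addO] at h
  | some a' => simp only [addO, Option.map_some, Option.some.injEq] at h; rw [← h, eval_add, ha a' rfl]

end Aff

/-! ## Frame coordinates and charts of a typed element -/

namespace ElemQ

variable (e : ElemQ)

/-- The orientation code. [folklore] -/
def o : ElemQ → Fin 8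
  | run r => r.o
  | dg d => d.o

/-- The upper slope bound of the material map. [folklore] -/
def whi : ElemQ → ℚ
  | run r => r.whi
  | dg d => d.whi

/-- Integer coefficients of the frame abscissa `u` as a linear form in `z`. [folklore] -/
def uC : ElemQ → ℤ × ℤ
  | run r => (d4a r.o, d4b r.o)
  | dg d => (d4a d.o - d4c d.o, d4b d.o - d4d d.o)

/-- Integer coefficients of the frame ordinate `v` as a linear form in `z`. [folklore] -/
def vC : ElemQ → ℤ × ℤ
  | run r => (d4c r.o, d4d r.o)
  | dg d => (d4a d.o + d4c d.o, d4b d.o + d4d d.o)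

/-- **Frame abscissa** of a lab point. [folklore] -/
def uOf (e : ElemQ) (z : E²) : ℝ := (e.uC.1 : ℝ) * z 0 + (e.uC.2 : ℝ) * z 1

/-- **Frame ordinate** of a lab point. [folklore] -/
def vOf (e : ElemQ) (z : E²) : ℝ := (e.vC.1 : ℝ) * z 0 + (e.vC.2 : ℝ) * z 1

/-- The frame abscissa of a run is `(A z)₀`. [folklore] -/
theorem uOf_run (r : RunQ) (z : E²) : (run r).uOf z = ((d4Frame r.o).app z) 0 := by
  simp [uOf, uC, LinFrame.app_apply, vec2_apply_zero]

/-- The frame ordinate of a run is `(A z)₁`. [folklore] -/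
theorem vOf_run (r : RunQ) (z : E²) : (run r).vOf z = ((d4Frame r.o).app z) 1 := by
  simp [vOf, vC, LinFrame.app_apply, vec2_apply_one]

/-- The frame abscissa of a diagonal band is `(diagFrame (A z))₀`. [folklore] -/
theorem uOf_dg (d : DgQ) (z : E²) : (dg d).uOf z = (diagFrame ((d4Frame d.o).app z)) 0 := by
  simp [uOf, uC, LinFrame.app_apply, diagFrame_apply, vec2_apply_zero, vec2_apply_one]; ring

/-- The frame ordinate of a diagonal band is `(diagFrame (A z))₁`. [folklore] -/
theorem vOf_dg (d : DgQ) (z : E²) : (dg d).vOf z = (diagFrame ((d4Frame d.o).app z)) 1 := by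
  simp [vOf, vC, LinFrame.app_apply, diagFrame_apply, vec2_apply_zero, vec2_apply_one]; ring

/-- The determinant of the frame as a rational number. [folklore] -/
def detQ (e : ElemQ) : ℚ := d4a e.o * d4d e.o - d4b e.o * d4c e.o

/-- The rational determinant is the real determinant. [folklore] -/
theorem detQ_cast : (e.detQ : ℝ) = (d4Frame e.o).det := by
  simp [detQ, LinFrame.det]

/-- The rational determinant is nonzero. [folklore] -/
theorem detQ_ne_zero : (e.detQ : ℝ) ≠ 0 := by rw [detQ_cast]; exact (d4Frame e.o).det_ne_zero

/-- **Rational coefficients of the chart**: `(e.chart u v) i = (chartC i).1 u + (chartC i).2 v`. [folklore] -/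
def chartC (e : ElemQ) (i : Fin 2) : ℚ × ℚ :=
  match e with
  | run r =>
    if i = 0 then (d4d r.o / (run r).detQ, -d4b r.o / (run r).detQ)
    else (-d4c r.o / (run r).detQ, d4a r.o / (run r).detQ)
  | dg d =>
    if i = 0 then ((d4d d.o + d4b d.o) / (2 * (dg d).detQ), (d4d d.o - d4b d.o) / (2 * (dg d).detQ))
    else ((-d4c d.o - d4a d.o) / (2 * (dg d).detQ), (d4a d.o - d4c d.o) / (2 * (dg d).detQ))

/-- **The chart**: the lab point with frame coordinates `(u, v)`. [folklore] -/
def chart (e : ElemQ) (u v : ℝ) : E² :=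
  match e with
  | run r => (d4Frame r.o).inv (vec2 u v)
  | dg d => (d4Frame d.o).inv (diagFrameInv (vec2 u v))

/-- **The chart in coordinates.** [folklore] -/
theorem chart_apply (u v : ℝ) (i : Fin 2) : (e.chart u v) i = (e.chartC i).1 * u + (e.chartC i).2 * v := by
  cases e with
  | run r =>
    obtain ⟨o, y, Ξ, wlo, whi, cR, cK⟩ := r
    fin_cases i <;> fin_cases o <;> dsimp only <;>
      norm_num [Fin.zero_eta, Fin.mk_one, chart, chartC, detQ, ElemQ.o, d4Frame, d4a, d4b, d4c, d4d,
        LinFrame.inv_apply, LinFrame.det, vec2_apply_zero, vec2_apply_one] <;> ring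
  | dg d =>
    obtain ⟨o, T, Ξ, wlo, whi, cR, cK⟩ := d
    fin_cases i <;> fin_cases o <;> dsimp only <;>
      norm_num [Fin.zero_eta, Fin.mk_one, chart, chartC, detQ, ElemQ.o, d4Frame, d4a, d4b, d4c, d4d,
        LinFrame.inv_apply, LinFrame.det, diagFrameInv_apply, vec2_apply_zero, vec2_apply_one] <;> ring

/-- **The chart inverts the frame coordinates.** [folklore] -/
theorem chart_uOf_vOf (z : E²) : e.chart (e.uOf z) (e.vOf z) = z := by
  cases e with
  | run r => rw [uOf_run, vOf_run, chart, vec2_apply_eq, LinFrame.inv_app]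
  | dg d => rw [uOf_dg, vOf_dg, chart, vec2_apply_eq, diagFrameInv_diagFrame, LinFrame.inv_app]

/-- **The line of the band** at clock value `α` and abscissa `u`: the transverse line of a run, the
profile of a diagonal band. [folklore] -/
def line (e : ElemQ) (α u : ℝ) : ℝ :=
  match e with
  | run r => r.y.eval α
  | dg d => d.T.val α u

/-- The material map of the element. [folklore] -/
def xi : ElemQ → Pw
  | run r => r.Ξ
  | dg d => d.Ξ

/-- The lower slope bound of the material map. [folklore] -/
def wlo : ElemQ → ℚ
  | run r => r.wlo
  | dg d => d.wlo

/-- A valid element has a valid material map. [folklore] -/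
theorem matValid_of_validB (hv : e.validB = true) : e.xi.matValidB e.wlo e.whi = true := by
  cases e with
  | run r => exact hv
  | dg d => exact DgQ.matValid_of_validB hv

/-- The slope of a valid material map is at most `whi`. [folklore] -/
theorem du_le_whi (hv : e.validB = true) {α : ℝ} (hα : α ∈ Icc (0 : ℝ) 1) (u : ℝ) : e.xi.du α u ≤ e.whi := by
  have hm := e.matValid_of_validB hv
  simp only [Pw.matValidB, Bool.and_eq_true] at hm
  exact (Pw.du_mem_Icc_of_checks hm.1.1.1 hm.1.1.2 hm.1.2 hα u).2

/-- **Tight band membership in frame coordinates.** [folklore] -/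
theorem mem_bandT_iff (t₀ τ r₀ : ℝ) (p : ℝ × E²) :
    p ∈ e.bandT t₀ τ r₀ ↔ |e.vOf p.2 - e.line (clock t₀ τ p.1) (e.uOf p.2)| ≤ r₀ * e.xi.du (clock t₀ τ p.1) (e.uOf p.2) := by
  cases e with
  | run r => simp only [bandT, mem_setOf_eq, vOf_run, uOf_run, line, RunQ.yF, xi, Pw.cdu]
  | dg d => simp only [bandT, mem_setOf_eq, vOf_dg, uOf_dg, line, Pw.cval, xi, Pw.cdu]

end ElemQ

/-! ## Slabs of the profile on a regime -/

namespace Pw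

variable (F : Pw)

/-- **Gap intercept** `C_m(α) = c(α) - Σ_{i<m} Jᵢ(α) (bᵢ(α) + ℓᵢ/2)`. [folklore] -/
def Cgap (m : ℕ) (α : ℝ) : ℝ :=
  F.c.eval α - ((F.kinks.take m).map fun k => k.J.eval α * (k.b.eval α + (k.ℓ : ℝ) / 2)).sum

/-- A sum of affine terms splits into slope and intercept. [folklore] -/
theorem sum_map_affine (L : List Kink) (α u : ℝ) :
    (L.map fun k => k.J.eval α * (u - k.b.eval α - (k.ℓ : ℝ) / 2)).sum =
      (L.map fun k => k.J.eval α).sum * u - (L.map fun k => k.J.eval α * (k.b.eval α + (k.ℓ : ℝ) / 2)).sum := by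
  induction L with
  | nil => simp
  | cons k L ih => simp only [List.map_cons, List.sum_cons, ih]; ring

/-- **The gap value is `C_m + W_m u`.** [folklore] -/
theorem gapVal_eq (m : ℕ) (α u : ℝ) : F.gapVal m α u = F.Cgap m α + F.W m α * u := by
  rw [gapVal, Cgap, W, sum_map_affine]; ring

/-- One step of the fold computing the rational gap intercept. [folklore] -/
def cgapStep (k : Kink) (acc : Option Aff) : Option Aff :=
  acc.bind fun a => (Aff.mulO k.J (k.b.add (Aff.const (k.ℓ / 2)))).map fun p => a.sub p

/-- **The gap intercept as rational data** (constancy rule on each product `Jᵢ · bᵢ`). [folklore] -/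
def CgapO (F : Pw) (m : ℕ) : Option Aff := (F.kinks.take m).foldr cgapStep (some F.c)

/-- Soundness of the folded intercept. [folklore] -/
theorem eval_foldr_cgapStep (L : List Kink) (c : Aff) (α : ℝ) :
    ∀ {A : Aff}, L.foldr cgapStep (some c) = some A →
      A.eval α = c.eval α - (L.map fun k => k.J.eval α * (k.b.eval α + (k.ℓ : ℝ) / 2)).sum := by
  induction L with
  | nil => intro A h; simp only [List.foldr_nil, Option.some.injEq] at h; subst h; simp
  | cons k L ih =>
    intro A h
    rw [List.foldr_cons] at h
    cases hrest : L.foldr cgapStep (some c) with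
    | none => rw [hrest] at h; simp [cgapStep] at h
    | some A' =>
      rw [hrest] at h
      cases hm : Aff.mulO k.J (k.b.add (Aff.const (k.ℓ / 2))) with
      | none => simp [cgapStep, hm] at h
      | some p =>
        simp only [cgapStep, hm, Option.bind_some, Option.map_some, Option.some.injEq] at h
        subst h
        rw [Aff.eval_sub, ih hrest, Aff.eval_of_mulO hm, Aff.eval_add, Aff.eval_const, List.map_cons, List.sum_cons]
        push_cast; ring

/-- **Soundness of the rational gap intercept.** [folklore] -/
theorem eval_CgapO {m : ℕ} {A : Aff} (h : F.CgapO m = some A) (α : ℝ) : A.eval α = F.Cgap m α :=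
  eval_foldr_cgapStep _ _ α h

/-- Absolute bound of a datum on `[0,1]` (rational). [folklore] -/
def _root_.Literature.Analysis.FluidPDE.PlanarKinematics.Aff.absMax (a : Aff) : ℚ := max |a.v0| |a.v1|

/-- The absolute bound bounds the value on `[0,1]`. [folklore] -/
theorem _root_.Literature.Analysis.FluidPDE.PlanarKinematics.Aff.abs_eval_le (a : Aff) {α : ℝ} (hα : α ∈ Icc (0 : ℝ) 1) :
    |a.eval α| ≤ a.absMax := by
  obtain ⟨h0, h1⟩ := hα
  rw [Aff.eval_apply, Aff.absMax]; push_cast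
  set M := max |(a.v0 : ℝ)| |(a.v1 : ℝ)| with hM
  have hv0 : |(a.v0 : ℝ)| ≤ M := le_max_left _ _
  have hv1 : |(a.v1 : ℝ)| ≤ M := le_max_right _ _
  have e : (a.v0 : ℝ) + ((a.v1 : ℝ) - a.v0) * α = (1 - α) * a.v0 + α * a.v1 := by ring
  rw [e]
  calc |(1 - α) * (a.v0 : ℝ) + α * a.v1| ≤ |(1 - α) * (a.v0 : ℝ)| + |α * (a.v1 : ℝ)| := abs_add_le _ _
    _ = (1 - α) * |(a.v0 : ℝ)| + α * |(a.v1 : ℝ)| := by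
        rw [abs_mul, abs_mul, abs_of_nonneg (by linarith), abs_of_nonneg h0]
    _ ≤ (1 - α) * M + α * M := add_le_add (mul_le_mul_of_nonneg_left hv0 (by linarith)) (mul_le_mul_of_nonneg_left hv1 h0)
    _ = M := by ring

/-- **Regime validity** of the `u`-interval `[ua, ub]` at clock value `α` (real side): the kinks
before the regime index are fully passed at `ua`, the kinks from the index on have not begun at
`ub` (`gap`), resp. kink `m` is at most at the end of its transition at `ub` (`trans`). [folklore] -/
def RegOK (F : Pw) (reg : RegQ) (α ua ub : ℝ) : Prop :=
  match reg with
  | .flat => True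
  | .gap m => (∀ k ∈ F.kinks.take m, k.b.eval α + 2 * (k.ℓ : ℝ) / 3 ≤ ua) ∧
      (∀ k ∈ F.kinks.drop m, ub ≤ k.b.eval α + (k.ℓ : ℝ) / 3)
  | .trans m => (∀ k ∈ F.kinks.take m, k.b.eval α + 2 * (k.ℓ : ℝ) / 3 ≤ ua) ∧
      (∀ k ∈ F.kinks.drop (m + 1), ub ≤ k.b.eval α + (k.ℓ : ℝ) / 3) ∧
      (∀ k ∈ F.kinks[m]?, ub ≤ k.b.eval α + 2 * (k.ℓ : ℝ) / 3)

/-- **Boolean regime validity** (endpoint checks). [folklore] -/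
def regOKB (F : Pw) (reg : RegQ) (ua ub : Aff) : Bool :=
  match reg with
  | .flat => true
  | .gap m => ((F.kinks.take m).all fun k => Aff.leB (k.edge (2 / 3)) ua) &&
      ((F.kinks.drop m).all fun k => Aff.leB ub (k.edge (1 / 3)))
  | .trans m => ((F.kinks.take m).all fun k => Aff.leB (k.edge (2 / 3)) ua) &&
      ((F.kinks.drop (m + 1)).all fun k => Aff.leB ub (k.edge (1 / 3))) &&
      ((F.kinks[m]?.toList).all fun k => Aff.leB ub (k.edge (2 / 3)))

/-- **Soundness of the regime test.** [folklore] -/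
theorem regOK_of_regOKB {reg : RegQ} {ua ub : Aff} (h : F.regOKB reg ua ub = true) {α : ℝ} (hα : α ∈ Icc (0 : ℝ) 1) :
    F.RegOK reg α (ua.eval α) (ub.eval α) := by
  cases reg with
  | flat => trivial
  | gap m =>
    simp only [regOKB, Bool.and_eq_true, List.all_eq_true] at h
    refine ⟨fun k hk => ?_, fun k hk => ?_⟩
    · have e := Aff.eval_le_eval (h.1 k hk) hα; rw [Kink.eval_edge] at e; push_cast at e; linarith
    · have e := Aff.eval_le_eval (h.2 k hk) hα; rw [Kink.eval_edge] at e; push_cast at e; linarith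
  | trans m =>
    simp only [regOKB, Bool.and_eq_true, List.all_eq_true] at h
    refine ⟨fun k hk => ?_, fun k hk => ?_, fun k hk => ?_⟩
    · have e := Aff.eval_le_eval (h.1.1 k hk) hα; rw [Kink.eval_edge] at e; push_cast at e; linarith
    · have e := Aff.eval_le_eval (h.1.2 k hk) hα; rw [Kink.eval_edge] at e; push_cast at e; linarith
    · have e := Aff.eval_le_eval (h.2 k (by rw [Option.mem_toList]; exact Option.mem_def.1 hk)) hα
      rw [Kink.eval_edge] at e; push_cast at e; linarith

/-- On a valid gap interval every abscissa is in the gap regime. [folklore] -/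
theorem inGap_of_regOK {m : ℕ} {α ua ub : ℝ} (h : F.RegOK (.gap m) α ua ub) {u : ℝ} (hu : u ∈ Icc ua ub) :
    F.InGap m α u :=
  ⟨fun k hk => (h.1 k hk).trans hu.1, fun k hk => hu.2.trans (h.2 k hk)⟩

/-- A sum over the kinks split at index `m` with one distinguished term. [folklore] -/
theorem sum_kinks_split (f : Kink → ℝ) (m : ℕ) (h : ∀ k ∈ F.kinks.drop (m + 1), f k = 0) :
    (F.kinks.map f).sum = ((F.kinks.take m).map f).sum + ((F.kinks[m]?.toList).map f).sum := by
  conv_lhs => rw [← List.take_append_drop m F.kinks]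
  rw [List.map_append, List.sum_append]
  congr 1
  rw [List.drop_eq_getElem?_toList_append, List.map_append, List.sum_append]
  have h0 : ((F.kinks.drop (m + 1)).map f).sum = 0 :=
    List.sum_eq_zero fun x hx => by
      obtain ⟨k, hk, rfl⟩ := List.mem_map.1 hx
      exact h k hk
  rw [h0, add_zero]

/-- **On a valid transition interval the profile is the gap value plus the distinguished kink.**
[folklore] -/
theorem val_eq_gapVal_add (hF : F.LenPos) {m : ℕ} {α ua ub : ℝ} (h : F.RegOK (.trans m) α ua ub) {u : ℝ}
    (hu : u ∈ Icc ua ub) : F.val α u = F.gapVal m α u + ((F.kinks[m]?.toList).map fun k => k.val α u).sum := by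
  rw [val, gapVal, F.sum_kinks_split (fun k => k.val α u) m fun k hk =>
    k.val_of_le (hF k (List.mem_of_mem_drop hk)) (hu.2.trans (h.2.1 k hk))]
  have e : ((F.kinks.take m).map fun k => k.val α u) = (F.kinks.take m).map fun k => k.J.eval α * (u - k.b.eval α - k.ℓ / 2) :=
    List.map_congr_left fun k hk => k.val_of_ge (hF k (List.mem_of_mem_take hk)) ((h.1 k hk).trans hu.1)
  rw [e]; ring

/-- **Upper ramp bound of a piece** (rational): `0` if the piece ends before the transition,
`ub - b - ℓ/3` if it ends in the first half of the transition, `ℓ/6` otherwise. [folklore] -/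
def _root_.Literature.Analysis.FluidPDE.PlanarKinematics.Kink.rampHi (k : Kink) (ub : Aff) : Aff :=
  if Aff.leB ub (k.edge (1 / 3)) then Aff.const 0
  else if Aff.leB (k.edge (1 / 3)) ub && Aff.leB ub (k.edge (1 / 2)) then ub.sub (k.edge (1 / 3))
  else Aff.const (k.ℓ / 6)

/-- **Lower ramp bound of a piece** (rational): `ua - b - ℓ/2` if the piece starts past the middle
of the transition, `0` otherwise. [folklore] -/
def _root_.Literature.Analysis.FluidPDE.PlanarKinematics.Kink.rampLo (k : Kink) (ua : Aff) : Aff :=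
  if Aff.leB (k.edge (1 / 2)) ua then ua.sub (k.edge (1 / 2)) else Aff.const 0

/-- **Soundness of the upper ramp bound** on a piece ending at most at the end of the transition. [folklore] -/
theorem _root_.Literature.Analysis.FluidPDE.PlanarKinematics.Kink.rampAt_le_rampHi (k : Kink) (hℓ : 0 < (k.ℓ : ℝ))
    {ub : Aff} {α : ℝ} (hα : α ∈ Icc (0 : ℝ) 1) {u : ℝ} (hu : u ≤ ub.eval α) (hend : ub.eval α ≤ k.b.eval α + 2 * (k.ℓ : ℝ) / 3) :
    rampAt (k.b.eval α) k.ℓ u ≤ (k.rampHi ub).eval α := by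
  unfold Kink.rampHi
  split_ifs with h1 h2
  · have e := Aff.eval_le_eval h1 hα
    rw [Kink.eval_edge] at e; push_cast at e
    rw [Aff.eval_const, Rat.cast_zero, rampAt_of_le hℓ (by linarith)]
  · simp only [Bool.and_eq_true] at h2
    rw [Aff.eval_sub, Kink.eval_edge]; push_cast
    rw [rampAt_apply]
    have hs := stepRamp_le ((u - k.b.eval α) / k.ℓ)
    have hx : (u - k.b.eval α) / ↑k.ℓ - 1 / 3 ≤ (ub.eval α - k.b.eval α - k.ℓ / 3) / k.ℓ := by
      rw [div_sub' (hc := hℓ.ne'), div_le_div_iff_of_pos_right hℓ]; linarith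
    have h0 : 0 ≤ (ub.eval α - k.b.eval α - k.ℓ / 3) / k.ℓ := by
      have e := Aff.eval_le_eval h2.1 hα
      rw [Kink.eval_edge] at e; push_cast at e
      exact div_nonneg (by linarith) hℓ.le
    calc (k.ℓ : ℝ) * stepRamp ((u - k.b.eval α) / k.ℓ) ≤ k.ℓ * ((ub.eval α - k.b.eval α - k.ℓ / 3) / k.ℓ) :=
        mul_le_mul_of_nonneg_left (hs.trans (max_le hx h0)) hℓ.le
      _ = ub.eval α - (k.b.eval α + 1 / 3 * k.ℓ) := by field_simp; ring
  · rw [Aff.eval_const, rampAt_apply]; push_cast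
    have hx : (u - k.b.eval α) / k.ℓ ≤ 2 / 3 := by rw [div_le_iff₀ hℓ]; linarith
    calc (k.ℓ : ℝ) * stepRamp ((u - k.b.eval α) / k.ℓ) ≤ k.ℓ * stepRamp (2 / 3) :=
        mul_le_mul_of_nonneg_left (stepRamp_monotone hx) hℓ.le
      _ = k.ℓ / 6 := by rw [stepRamp_of_ge le_rfl]; ring

/-- **Soundness of the lower ramp bound.** [folklore] -/
theorem _root_.Literature.Analysis.FluidPDE.PlanarKinematics.Kink.rampLo_le_rampAt (k : Kink) (hℓ : 0 < (k.ℓ : ℝ))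
    {ua : Aff} {α : ℝ} {u : ℝ} (hu : ua.eval α ≤ u) : (k.rampLo ua).eval α ≤ rampAt (k.b.eval α) k.ℓ u := by
  unfold Kink.rampLo
  split_ifs
  · rw [Aff.eval_sub, Kink.eval_edge, rampAt_apply]; push_cast
    have hs := sub_half_le_stepRamp ((u - k.b.eval α) / k.ℓ)
    calc ua.eval α - (k.b.eval α + 1 / 2 * k.ℓ) ≤ k.ℓ * ((u - k.b.eval α) / k.ℓ - 1 / 2) := by
          field_simp; linarith
      _ ≤ k.ℓ * stepRamp ((u - k.b.eval α) / k.ℓ) := mul_le_mul_of_nonneg_left hs hℓ.le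
  · rw [Aff.eval_const, Rat.cast_zero, rampAt_apply]
    exact mul_nonneg hℓ.le (stepRamp_nonneg _)

/-- **Slab add-ons of a transition piece** (rational, constancy rule on `J · bound`): the profile
minus its gap value lies in `[δlo, δhi]`; the sign of `J` must be definite. [folklore] -/
def transSlabO (F : Pw) (m : ℕ) (ua ub : Aff) : Option (Aff × Aff) :=
  match F.kinks[m]? with
  | none => some (Aff.const 0, Aff.const 0)
  | some k =>
    if Aff.leB k.J (Aff.const 0) then
      match Aff.mulO k.J (k.rampHi ub), Aff.mulO k.J (k.rampLo ua) with
      | some lo, some hi => some (lo, hi)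
      | _, _ => none
    else if Aff.leB (Aff.const 0) k.J then
      match Aff.mulO k.J (k.rampLo ua), Aff.mulO k.J (k.rampHi ub) with
      | some lo, some hi => some (lo, hi)
      | _, _ => none
    else none

/-- **Soundness of the transition slab**: on a valid transition piece the profile lies between the
gap value plus `δlo` and plus `δhi`. [folklore] -/
theorem val_sub_gapVal_mem (hF : F.LenPos) {m : ℕ} {ua ub : Aff} {lo hi : Aff} (h : F.transSlabO m ua ub = some (lo, hi))
    {α : ℝ} (hα : α ∈ Icc (0 : ℝ) 1) (hreg : F.RegOK (.trans m) α (ua.eval α) (ub.eval α)) {u : ℝ}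
    (hu : u ∈ Icc (ua.eval α) (ub.eval α)) : F.val α u - F.gapVal m α u ∈ Icc (lo.eval α) (hi.eval α) := by
  rw [F.val_eq_gapVal_add hF hreg hu, add_sub_cancel_left]
  unfold transSlabO at h
  cases hk : F.kinks[m]? with
  | none => rw [hk] at h; simp only [Option.some.injEq, Prod.mk.injEq] at h; obtain ⟨rfl, rfl⟩ := h; simp
  | some k =>
    rw [hk] at h
    have hkm : k ∈ F.kinks := List.mem_of_getElem? hk
    have hℓ : 0 < (k.ℓ : ℝ) := hF k hkm
    have hend : ub.eval α ≤ k.b.eval α + 2 * (k.ℓ : ℝ) / 3 := hreg.2.2 k (by rw [hk]; rfl)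
    have hhi := k.rampAt_le_rampHi hℓ hα hu.2 hend
    have hlo := k.rampLo_le_rampAt hℓ hu.1
    simp only [Option.toList_some, List.map_cons, List.map_nil, List.sum_cons, List.sum_nil, add_zero, Kink.val]
    dsimp only at h
    split_ifs at h with hJ hJ'
    · -- `J ≤ 0`
      cases h1 : Aff.mulO k.J (k.rampHi ub) with
      | none => rw [h1] at h; simp at h
      | some lo' =>
        cases h2 : Aff.mulO k.J (k.rampLo ua) with
        | none => rw [h1, h2] at h; simp at h
        | some hi' =>
          rw [h1, h2] at h
          simp only [Option.some.injEq, Prod.mk.injEq] at h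
          obtain ⟨rfl, rfl⟩ := h
          have hJ0 : k.J.eval α ≤ 0 := by have := Aff.eval_le_eval hJ hα; rwa [Aff.eval_const, Rat.cast_zero] at this
          rw [Aff.eval_of_mulO h1, Aff.eval_of_mulO h2]
          exact ⟨mul_le_mul_of_nonpos_left hhi hJ0, mul_le_mul_of_nonpos_left hlo hJ0⟩
    · -- `0 ≤ J`
      cases h1 : Aff.mulO k.J (k.rampLo ua) with
      | none => rw [h1] at h; simp at h
      | some lo' =>
        cases h2 : Aff.mulO k.J (k.rampHi ub) with
        | none => rw [h1, h2] at h; simp at h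
        | some hi' =>
          rw [h1, h2] at h
          simp only [Option.some.injEq, Prod.mk.injEq] at h
          obtain ⟨rfl, rfl⟩ := h
          have hJ0 : 0 ≤ k.J.eval α := by have := Aff.eval_le_eval hJ' hα; rwa [Aff.eval_const, Rat.cast_zero] at this
          rw [Aff.eval_of_mulO h1, Aff.eval_of_mulO h2]
          exact ⟨mul_le_mul_of_nonneg_left hlo hJ0, mul_le_mul_of_nonneg_left hhi hJ0⟩

/-! ### Local slope bounds: extended gaps and dominating gap slopes

The global bound `du_mem_Icc_of_W` (all gap slopes) is too coarse for a piece of a run carrying a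
fat flex site next to thin zones. Locally: the **extended gap** `g` runs from where kink `g - 1`
begins (`b + ℓ/3`) to where kink `g` is fully passed (`b + 2ℓ/3`); these cover the line, and at a
point of extended gaps `g ≤ g'` (`g' ≤ g + 1`) the slope is a convex combination of `W g` and
`W g'`. Hence `Ξᵤ ≤ B` on a piece as soon as `W g ≤ B` for every extended gap `g` the piece meets. -/

/-- **Extended gap** `g` at clock value `α`: kink `g - 1` (if any) has begun, `b + ℓ/3 ≤ u`, and kink
`g` (if any) is not fully passed, `u ≤ b + 2ℓ/3`. [folklore] -/
def InEG (F : Pw) (g : ℕ) (α u : ℝ) : Prop :=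
  (∀ k, g ≠ 0 → F.kinks[g - 1]? = some k → k.b.eval α + (k.ℓ : ℝ) / 3 ≤ u) ∧
    (∀ k, F.kinks[g]? = some k → u ≤ k.b.eval α + 2 * (k.ℓ : ℝ) / 3)

/-- Slope of a kink list with base slope `s₀`. [folklore] -/
private def duL (s₀ : ℝ) (L : List Kink) (α u : ℝ) : ℝ := s₀ + (L.map fun k => k.du α u).sum

/-- Gap slopes of a kink list with base slope `s₀`. [folklore] -/
private def WL (s₀ : ℝ) (L : List Kink) (m : ℕ) (α : ℝ) : ℝ := s₀ + ((L.take m).map fun k => k.J.eval α).sum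

/-- Extended gaps of a kink list. [folklore] -/
private def InEGL (L : List Kink) (g : ℕ) (α u : ℝ) : Prop :=
  (∀ k, g ≠ 0 → L[g - 1]? = some k → k.b.eval α + (k.ℓ : ℝ) / 3 ≤ u) ∧
    (∀ k, L[g]? = some k → u ≤ k.b.eval α + 2 * (k.ℓ : ℝ) / 3)

/-- Appending a kink adds its slope contribution. [folklore] -/
private theorem duL_append (s₀ : ℝ) (L : List Kink) (k : Kink) (α u : ℝ) :
    duL s₀ (L ++ [k]) α u = duL s₀ L α u + k.du α u := by
  simp [duL, List.map_append, List.sum_append, add_assoc]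

/-- Gap slopes of index `≤ |L|` do not see an appended kink. [folklore] -/
private theorem WL_append_of_le (s₀ : ℝ) (L : List Kink) (k : Kink) {m : ℕ} (hm : m ≤ L.length) (α : ℝ) :
    WL s₀ (L ++ [k]) m α = WL s₀ L m α := by
  simp [WL, List.take_append_of_le_length hm]

/-- The last gap slope after appending a kink. [folklore] -/
private theorem WL_length_succ (s₀ : ℝ) (L : List Kink) (k : Kink) (α : ℝ) :
    WL s₀ (L ++ [k]) (L.length + 1) α = WL s₀ L L.length α + k.J.eval α := by
  simp [WL, List.take_length_add_append, List.map_append, List.sum_append, add_assoc]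

/-- With separated kinks and positive lengths, every kink of `L` is fully passed where an appended
kink begins. [folklore] -/
private theorem passed_of_append (α : ℝ) :
    ∀ (L : List Kink) (k : Kink), (∀ k' ∈ L ++ [k], 0 < (k'.ℓ : ℝ)) → KinksSep (L ++ [k]) α →
      ∀ k' ∈ L, k'.b.eval α + 2 * (k'.ℓ : ℝ) / 3 ≤ k.b.eval α + (k.ℓ : ℝ) / 3 := by
  intro L
  induction L using List.reverseRecOn with
  | nil => intro k _ _ k' hk'; simp at hk'
  | append_singleton L k₂ ih =>
    intro k hℓ hsep k' hk'
    have hsep' : KinksSep (L ++ [k₂]) α := (List.isChain_append.1 hsep).1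
    have hlast : k₂.b.eval α + 2 * (k₂.ℓ : ℝ) / 3 ≤ k.b.eval α + (k.ℓ : ℝ) / 3 :=
      (List.isChain_append.1 hsep).2.2 k₂ (by simp) k (by simp)
    have hℓ' : ∀ k' ∈ L ++ [k₂], 0 < (k'.ℓ : ℝ) := fun k' hk' => hℓ k' (by simp at hk' ⊢; tauto)
    have hℓ₂ : 0 < (k₂.ℓ : ℝ) := hℓ k₂ (by simp)
    rcases List.mem_append.1 hk' with h | h
    · have := ih k₂ hℓ' hsep' k' h
      linarith
    · simp only [List.mem_singleton] at h
      subst h; exact hlast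

/-- Past all transitions of `L` the slope is the last gap slope. [folklore] -/
private theorem duL_eq_WL_of_passed (s₀ α u : ℝ) (L : List Kink) (hℓ : ∀ k ∈ L, 0 < (k.ℓ : ℝ))
    (hp : ∀ k ∈ L, k.b.eval α + 2 * (k.ℓ : ℝ) / 3 ≤ u) : duL s₀ L α u = WL s₀ L L.length α := by
  simp only [duL, WL, List.take_length]
  congr 1
  exact congrArg List.sum (List.map_congr_left fun k hk => k.du_of_ge (hℓ k hk) (hp k hk))

/-- The slope of a kink list is bounded by any bound of the gap slopes of the extended gaps
containing the point. [folklore] -/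
private theorem duL_le (s₀ α u B : ℝ) :
    ∀ L : List Kink, (∀ k ∈ L, 0 < (k.ℓ : ℝ)) → KinksSep L α →
      (∀ g ≤ L.length, InEGL L g α u → WL s₀ L g α ≤ B) → duL s₀ L α u ≤ B := by
  intro L
  induction L using List.reverseRecOn with
  | nil =>
    intro _ _ hW
    have h0 := hW 0 le_rfl ⟨fun k h _ => absurd rfl h, fun k hk => by simp at hk⟩
    simpa [duL, WL] using h0
  | append_singleton L k ih =>
    intro hℓ hsep hW
    have hℓL : ∀ k' ∈ L, 0 < (k'.ℓ : ℝ) := fun k' hk' => hℓ k' (List.mem_append_left _ hk')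
    have hℓk : 0 < (k.ℓ : ℝ) := hℓ k (by simp)
    have hsepL : KinksSep L α := (List.isChain_append.1 hsep).1
    rw [duL_append]
    rcases le_or_gt u (k.b.eval α + k.ℓ / 3) with hu | hu
    · -- the appended kink has not begun: reduce to `L`
      rw [k.du_of_le hℓk hu, add_zero]
      refine ih hℓL hsepL fun g hg hEG => ?_
      rw [← WL_append_of_le s₀ L k hg]
      refine hW g (by simp; omega) ⟨fun k' hg0 hk' => hEG.1 k' hg0 ?_, fun k' hk' => ?_⟩
      · rwa [List.getElem?_append_left (by omega)] at hk'
      · rcases Nat.lt_or_ge g L.length with hgl | hgl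
        · exact hEG.2 k' (by rwa [List.getElem?_append_left hgl] at hk')
        · have hgeq : g = L.length := le_antisymm hg hgl
          subst hgeq
          rw [List.getElem?_append_right le_rfl, Nat.sub_self, List.getElem?_cons_zero, Option.some.injEq] at hk'
          subst hk'; linarith
    · -- the appended kink has begun: all kinks of `L` are passed
      have hpass : ∀ k' ∈ L, k'.b.eval α + 2 * (k'.ℓ : ℝ) / 3 ≤ u := fun k' hk' => by
        have := passed_of_append α L k hℓ hsep k' hk'; linarith
      rw [duL_eq_WL_of_passed s₀ α u L hℓL hpass]
      have hWlast : WL s₀ (L ++ [k]) (L.length + 1) α ≤ B → WL s₀ L L.length α + k.J.eval α ≤ B := by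
        intro h; rwa [WL_length_succ] at h
      have hEG1 : InEGL (L ++ [k]) (L.length + 1) α u :=
        ⟨fun k' _ hk' => by
            rw [Nat.add_sub_cancel, List.getElem?_append_right le_rfl, Nat.sub_self, List.getElem?_cons_zero,
              Option.some.injEq] at hk'
            subst hk'; exact hu.le,
         fun k' hk' => by
            rw [List.getElem?_append_right (by omega), show L.length + 1 - L.length = 1 by omega] at hk'
            simp at hk'⟩
      have hB1 : WL s₀ L L.length α + k.J.eval α ≤ B := hWlast (hW (L.length + 1) (by simp) hEG1)
      rcases le_or_gt (k.b.eval α + 2 * k.ℓ / 3) u with hu2 | hu2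
      · rw [k.du_of_ge hℓk hu2]; exact hB1
      · -- inside the transition of `k`: both extended gaps `|L|` and `|L| + 1`
        have hEG0 : InEGL (L ++ [k]) L.length α u := by
          refine ⟨fun k' hL0 hk' => ?_, fun k' hk' => ?_⟩
          · rw [List.getElem?_append_left (by omega)] at hk'
            have hmem : k' ∈ L := List.mem_of_getElem? hk'
            have := hpass k' hmem
            have := hℓL k' hmem
            linarith
          · rw [List.getElem?_append_right le_rfl, Nat.sub_self, List.getElem?_cons_zero, Option.some.injEq] at hk'
            subst hk'; exact hu2.le
        have hB0 : WL s₀ L L.length α ≤ B := by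
          have := hW L.length (by simp) hEG0
          rwa [WL_append_of_le s₀ L k le_rfl] at this
        obtain ⟨θ, hθ, hdu⟩ := k.du_eq_smul α u
        rw [hdu]
        nlinarith [hθ.1, hθ.2, hB0, hB1]

/-- **Local slope bound**: with positive lengths and separated kinks, if `W g ≤ B` for every
extended gap `g` containing `u`, then `∂ᵤF(α, u) ≤ B`. [folklore] -/
theorem du_le_of_extendedGaps (hF : F.LenPos) {α : ℝ} (hsep : KinksSep F.kinks α) {u B : ℝ}
    (hW : ∀ g ≤ F.kinks.length, F.InEG g α u → F.W g α ≤ B) : F.du α u ≤ B :=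
  duL_le (F.s.eval α) α u B F.kinks hF hsep hW

/-- **Separation of a piece from an extended gap** (rational): the piece ends before kink `g - 1`
begins, or starts after kink `g` is fully passed (at both clock ends). [folklore] -/
def egSepB (F : Pw) (g : ℕ) (ua ub : Aff) : Bool :=
  (match (if g = 0 then none else F.kinks[g - 1]?) with
    | some k => ub.ltB (k.b.add (Aff.const (k.ℓ / 3)))
    | none => false) ||
  (match F.kinks[g]? with
    | some k => (k.b.add (Aff.const (2 * k.ℓ / 3))).ltB ua
    | none => false)

/-- **Soundness of the separation test**: no point of the piece lies in the extended gap. [folklore] -/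
theorem not_inEG_of_egSepB {g : ℕ} {ua ub : Aff} (h : F.egSepB g ua ub = true) {α : ℝ} (hα : α ∈ Icc (0 : ℝ) 1)
    {u : ℝ} (hu : u ∈ Icc (ua.eval α) (ub.eval α)) : ¬ F.InEG g α u := by
  intro hEG
  simp only [egSepB, Bool.or_eq_true] at h
  rcases h with h | h
  · by_cases hg : g = 0
    · simp [hg] at h
    · simp only [hg, ↓reduceIte] at h
      cases hk : F.kinks[g - 1]? with
      | none => rw [hk] at h; exact absurd h (by simp)
      | some k =>
        rw [hk] at h
        have h1 := Aff.eval_lt_eval h hα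
        rw [Aff.eval_add, Aff.eval_const] at h1
        have h2 := hEG.1 k hg hk
        push_cast at h1
        linarith [hu.2]
  · cases hk : F.kinks[g]? with
    | none => rw [hk] at h; exact absurd h (by simp)
    | some k =>
      rw [hk] at h
      have h1 := Aff.eval_lt_eval h hα
      rw [Aff.eval_add, Aff.eval_const] at h1
      have h2 := hEG.2 k hk
      push_cast at h1
      linarith [hu.1]

/-- **Dominator test** for a piece `[ua, ub]` and a nonempty list `ms` of gap indices: every
extended gap the piece can meet has its slope below the slope of some member of `ms`, at both
clock ends. [folklore] -/
def domOKB (F : Pw) (ms : List ℕ) (ua ub : Aff) : Bool :=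
  !ms.isEmpty && ms.all (fun m => decide (m ≤ F.kinks.length)) &&
    (List.range (F.kinks.length + 1)).all fun g => F.egSepB g ua ub || ms.any fun m => (F.WAff g).leB (F.WAff m)

/-- **Soundness of the dominator test**: on the piece the slope is below the largest dominator
slope, which is one of them. [folklore] -/
theorem exists_dominator (hF : F.LenPos) {α : ℝ} (hα : α ∈ Icc (0 : ℝ) 1) (hsep : KinksSep F.kinks α)
    {ms : List ℕ} {ua ub : Aff} (h : F.domOKB ms ua ub = true) {u : ℝ} (hu : u ∈ Icc (ua.eval α) (ub.eval α)) :
    ∃ m ∈ ms, F.du α u ≤ F.W m α := by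
  simp only [domOKB, Bool.and_eq_true, Bool.not_eq_true', List.isEmpty_eq_false_iff, List.all_eq_true,
    decide_eq_true_eq, Bool.or_eq_true, List.any_eq_true] at h
  obtain ⟨⟨hne, _⟩, hall⟩ := h
  obtain ⟨m₀, hm₀, hmax⟩ := ms.toFinset.exists_max_image (fun m => F.W m α) (by simpa using hne)
  refine ⟨m₀, by simpa using hm₀, F.du_le_of_extendedGaps hF hsep fun g hg hEG => ?_⟩
  rcases hall g (List.mem_range.2 (Nat.lt_succ_of_le hg)) with hs | ⟨m, hm, hle⟩
  · exact absurd hEG (F.not_inEG_of_egSepB hs hα hu)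
  · have h1 := Aff.eval_le_eval hle hα
    rw [F.eval_WAff, F.eval_WAff] at h1
    exact h1.trans (hmax m (by simpa using hm))

end Pw

/-! ## Slabs of a typed element on a regime -/

namespace ElemQ

variable (e : ElemQ)

/-- **Regime validity for an element**: trivial for a run, the profile regime for a diagonal band
(`flat` is not a regime of a diagonal band). [folklore] -/
def RegOK (e : ElemQ) (reg : RegQ) (α ua ub : ℝ) : Prop :=
  match e with
  | run _ => True
  | dg d => match reg with
    | .flat => False
    | _ => d.T.RegOK reg α ua ub

/-- Boolean regime validity for an element. [folklore] -/
def regOKB (e : ElemQ) (reg : RegQ) (ua ub : Aff) : Bool :=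
  match e with
  | run _ => true
  | dg d => match reg with
    | .flat => false
    | _ => d.T.regOKB reg ua ub

/-- Soundness of the regime test. [folklore] -/
theorem regOK_of_regOKB {reg : RegQ} {ua ub : Aff} (h : e.regOKB reg ua ub = true) {α : ℝ} (hα : α ∈ Icc (0 : ℝ) 1) :
    e.RegOK reg α (ua.eval α) (ub.eval α) := by
  cases e with
  | run r => trivial
  | dg d =>
    cases reg with
    | flat => simp [regOKB] at h
    | gap m => exact d.T.regOK_of_regOKB (reg := .gap m) h hα
    | trans m => exact d.T.regOK_of_regOKB (reg := .trans m) h hα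

/-- **Slope bounds of the material map on a piece** (rational): the gap slopes of the listed
dominating gaps, or the global bound `whi` for the empty list. [folklore] -/
def xiHis (e : ElemQ) (ms : List ℕ) : List Aff :=
  if ms.isEmpty then [Aff.const e.whi] else ms.map e.xi.WAff

/-- Boolean validity of a dominator list of a piece (the empty list is always valid). [folklore] -/
def xiRegOKB (e : ElemQ) (ms : List ℕ) (ua ub : Aff) : Bool :=
  ms.isEmpty || e.xi.domOKB ms ua ub

/-- **Soundness of the slope bounds on a piece**: at every point of the piece the slope is below
one of the listed bounds. [folklore] -/
theorem exists_xiHi (hv : e.validB = true) {ms : List ℕ} {ua ub : Aff} (hok : e.xiRegOKB ms ua ub = true) {α : ℝ}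
    (hα : α ∈ Icc (0 : ℝ) 1) {u : ℝ} (hu : u ∈ Icc (ua.eval α) (ub.eval α)) :
    ∃ B ∈ e.xiHis ms, e.xi.du α u ≤ B.eval α := by
  have hm := e.matValid_of_validB hv
  by_cases hms : ms.isEmpty = true
  · refine ⟨Aff.const e.whi, by simp [xiHis, hms], ?_⟩
    rw [Aff.eval_const]; exact e.du_le_whi hv hα u
  · simp only [xiRegOKB, hms, Bool.false_or] at hok
    have hF : e.xi.LenPos := Pw.lenPos_of_matValidB hm
    simp only [Pw.matValidB, Bool.and_eq_true] at hm
    have hsep := kinksSep_of_kinksSepB hm.1.1.2 hα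
    obtain ⟨m, hmm, hle⟩ := e.xi.exists_dominator hF hα hsep hok hu
    refine ⟨e.xi.WAff m, ?_, by rwa [Pw.eval_WAff]⟩
    simp only [xiHis, hms, Bool.false_eq_true, ↓reduceIte]
    exact List.mem_map.2 ⟨m, hmm, rfl⟩

/-- **Slab intercept** (real). [folklore] -/
def slabC (e : ElemQ) (reg : RegQ) (α : ℝ) : ℝ :=
  match e with
  | run r => r.y.eval α
  | dg d => match reg with
    | .flat => 0
    | .gap m => d.T.Cgap m α
    | .trans m => d.T.Cgap m α

/-- **Slab slope** (real). [folklore] -/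
def slabW (e : ElemQ) (reg : RegQ) (α : ℝ) : ℝ :=
  match e with
  | run _ => 0
  | dg d => match reg with
    | .flat => 0
    | .gap m => d.T.W m α
    | .trans m => d.T.W m α

/-- **Slab intercept as rational data** (constancy rule). [folklore] -/
def slabCO (e : ElemQ) (reg : RegQ) : Option Aff :=
  match e with
  | run r => some r.y
  | dg d => match reg with
    | .flat => none
    | .gap m => d.T.CgapO m
    | .trans m => d.T.CgapO m

/-- **Slab slope as rational data.** [folklore] -/
def slabWA (e : ElemQ) (reg : RegQ) : Aff :=
  match e with
  | run _ => Aff.const 0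
  | dg d => match reg with
    | .flat => Aff.const 0
    | .gap m => d.T.WAff m
    | .trans m => d.T.WAff m

/-- Soundness of the rational intercept. [folklore] -/
theorem eval_slabCO {reg : RegQ} {A : Aff} (h : e.slabCO reg = some A) (α : ℝ) : A.eval α = e.slabC reg α := by
  cases e with
  | run r => simp only [slabCO, Option.some.injEq] at h; subst h; rfl
  | dg d =>
    cases reg with
    | flat => simp [slabCO] at h
    | gap m => exact d.T.eval_CgapO h α
    | trans m => exact d.T.eval_CgapO h α

/-- Soundness of the rational slope. [folklore] -/
theorem eval_slabWA (reg : RegQ) (α : ℝ) : (e.slabWA reg).eval α = e.slabW reg α := by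
  cases e with
  | run r => simp [slabWA, slabW]
  | dg d =>
    cases reg with
    | flat => simp [slabWA, slabW]
    | gap m => exact d.T.eval_WAff m α
    | trans m => exact d.T.eval_WAff m α

/-- **Slab add-ons of a piece as rational data** `(δlo, δhi)`: `(0, 0)` for a run and on a gap,
the transition slab on a transition piece. [folklore] -/
def slabLoHiO (e : ElemQ) (reg : RegQ) (ua ub : Aff) : Option (Aff × Aff) :=
  match e with
  | run _ => some (Aff.const 0, Aff.const 0)
  | dg d => match reg with
    | .flat => none
    | .gap _ => some (Aff.const 0, Aff.const 0)
    | .trans m => d.T.transSlabO m ua ub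

/-- **The line lies in the slab** on a valid regime piece. [folklore] -/
theorem line_sub_mem (hv : e.validB = true) {reg : RegQ} {ua ub lo hi : Aff} (h : e.slabLoHiO reg ua ub = some (lo, hi))
    {α : ℝ} (hα : α ∈ Icc (0 : ℝ) 1) (hreg : e.RegOK reg α (ua.eval α) (ub.eval α)) {u : ℝ}
    (hu : u ∈ Icc (ua.eval α) (ub.eval α)) :
    e.line α u - (e.slabC reg α + e.slabW reg α * u) ∈ Icc (lo.eval α) (hi.eval α) := by
  cases e with
  | run r =>
    simp only [slabLoHiO, Option.some.injEq, Prod.mk.injEq] at h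
    obtain ⟨rfl, rfl⟩ := h
    simp [line, slabC, slabW]
  | dg d =>
    have hT : d.T.LenPos := DgQ.lenPosT_of_validB hv
    cases reg with
    | flat => simp [slabLoHiO] at h
    | gap m =>
      simp only [slabLoHiO, Option.some.injEq, Prod.mk.injEq] at h
      obtain ⟨rfl, rfl⟩ := h
      have hin := d.T.inGap_of_regOK hreg hu
      simp only [line, slabC, slabW]
      rw [d.T.val_eq_gapVal hT hin, d.T.gapVal_eq]; simp
    | trans m =>
      simp only [slabLoHiO] at h
      simp only [line, slabC, slabW]
      have key := d.T.val_sub_gapVal_mem hT h hα hreg hu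
      rw [d.T.gapVal_eq] at key
      exact key

/-- **Chart form of a band point on a piece**: if `u = uOf z` lies in a valid regime piece with slab
add-ons `(δlo, δhi)`, then `z = e.chart u (C + W u + w)` with `w ∈ [δlo - r₀ B, δhi + r₀ B]` for one of the
slope bounds `B` of the piece. [folklore] -/
theorem band_chart_form (hv : e.validB = true) {t₀ τ : ℝ} {r₀ : ℚ} (hr : 0 ≤ r₀) {p : ℝ × E²} (hp : p ∈ e.bandT t₀ τ r₀)
    {reg : RegQ} {ms : List ℕ} {ua ub lo hi : Aff} (h : e.slabLoHiO reg ua ub = some (lo, hi))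
    (hreg : e.RegOK reg (clock t₀ τ p.1) (ua.eval (clock t₀ τ p.1)) (ub.eval (clock t₀ τ p.1)))
    (hxi : e.xiRegOKB ms ua ub = true)
    (hu : e.uOf p.2 ∈ Icc (ua.eval (clock t₀ τ p.1)) (ub.eval (clock t₀ τ p.1))) :
    ∃ B ∈ e.xiHis ms, ∃ w : ℝ, w ∈ Icc ((lo.sub (Aff.smul r₀ B)).eval (clock t₀ τ p.1))
        ((hi.add (Aff.smul r₀ B)).eval (clock t₀ τ p.1)) ∧
      p.2 = e.chart (e.uOf p.2) (e.slabC reg (clock t₀ τ p.1) + e.slabW reg (clock t₀ τ p.1) * e.uOf p.2 + w) := by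
  set α := clock t₀ τ p.1 with hαdef
  have hα : α ∈ Icc (0 : ℝ) 1 := clock_mem_Icc t₀ τ p.1
  obtain ⟨B, hB, hduB⟩ := e.exists_xiHi hv hxi hα hu
  refine ⟨B, hB, e.vOf p.2 - (e.slabC reg α + e.slabW reg α * e.uOf p.2), ?_, ?_⟩
  · have h1 := abs_le.1 ((e.mem_bandT_iff t₀ τ r₀ p).1 hp)
    have h2 := e.line_sub_mem hv h hα hreg hu
    have h3 : (r₀ : ℝ) * e.xi.du α (e.uOf p.2) ≤ r₀ * B.eval α :=
      mul_le_mul_of_nonneg_left hduB (by exact_mod_cast hr)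
    rw [Aff.eval_sub, Aff.eval_add, Aff.eval_smul]
    constructor <;> linarith [h1.1, h1.2, h2.1, h2.2]
  · have e3 : e.slabC reg α + e.slabW reg α * e.uOf p.2 + (e.vOf p.2 - (e.slabC reg α + e.slabW reg α * e.uOf p.2)) = e.vOf p.2 := by
      ring
    rw [e3, e.chart_uOf_vOf]

end ElemQ

/-! ## Affine lab functionals and the corner principle -/

/-- **Affine lab functional with rational data**: `φ_α(z) = f₀ z₀ + f₁ z₁ + g(α)`. [folklore] -/
structure LinFun where
  /-- coefficient of `z₀` -/
  f0 : ℚ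
  /-- coefficient of `z₁` -/
  f1 : ℚ
  /-- clock-affine constant -/
  g : Aff
deriving DecidableEq, Inhabited

namespace LinFun

variable (φ : LinFun)

/-- Evaluation. [folklore] -/
def eval (α : ℝ) (z : E²) : ℝ := (φ.f0 : ℝ) * z 0 + (φ.f1 : ℝ) * z 1 + φ.g.eval α

/-- The `u`-coefficient of `φ ∘ chart` (without the slope part). [folklore] -/
def F1 (φ : LinFun) (e : ElemQ) : ℚ := φ.f0 * (e.chartC 0).1 + φ.f1 * (e.chartC 1).1

/-- The `v`-coefficient of `φ ∘ chart`. [folklore] -/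
def Q (φ : LinFun) (e : ElemQ) : ℚ := φ.f0 * (e.chartC 0).2 + φ.f1 * (e.chartC 1).2

/-- **`φ ∘ chart` along a slab is affine in `(u, w)`.** [folklore] -/
theorem eval_chart (e : ElemQ) (α u C W w : ℝ) :
    φ.eval α (e.chart u (C + W * u + w)) = ((φ.F1 e : ℝ) + (φ.Q e : ℝ) * W) * u + (φ.Q e : ℝ) * (C + w) + φ.g.eval α := by
  rw [eval, e.chart_apply, e.chart_apply, F1, Q]; push_cast; ring

/-- **Rectangle lemma**: an affine function of `(u, w)` which is `≤ 0` at the four corners of a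
rectangle is `≤ 0` on it. [folklore] -/
theorem le_on_rect {P Qc K ua ub wa wb u w : ℝ} (hu : u ∈ Icc ua ub) (hw : w ∈ Icc wa wb)
    (h1 : P * ua + Qc * wa + K ≤ 0) (h2 : P * ua + Qc * wb + K ≤ 0) (h3 : P * ub + Qc * wa + K ≤ 0)
    (h4 : P * ub + Qc * wb + K ≤ 0) : P * u + Qc * w + K ≤ 0 := by
  have hP : P * u ≤ max (P * ua) (P * ub) := by
    rcases le_total 0 P with hP | hP
    · exact (mul_le_mul_of_nonneg_left hu.2 hP).trans (le_max_right _ _)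
    · exact (mul_le_mul_of_nonpos_left hu.1 hP).trans (le_max_left _ _)
  have hQ : Qc * w ≤ max (Qc * wa) (Qc * wb) := by
    rcases le_total 0 Qc with hQ | hQ
    · exact (mul_le_mul_of_nonneg_left hw.2 hQ).trans (le_max_right _ _)
    · exact (mul_le_mul_of_nonpos_left hw.1 hQ).trans (le_max_left _ _)
  rcases max_choice (P * ua) (P * ub) with ha | ha <;> rcases max_choice (Qc * wa) (Qc * wb) with hb | hb <;>
    rw [ha] at hP <;> rw [hb] at hQ <;> linarith

/-- **Strict rectangle lemma.** [folklore] -/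
theorem lt_on_rect {P Qc K ua ub wa wb u w : ℝ} (hu : u ∈ Icc ua ub) (hw : w ∈ Icc wa wb)
    (h1 : P * ua + Qc * wa + K < 0) (h2 : P * ua + Qc * wb + K < 0) (h3 : P * ub + Qc * wa + K < 0)
    (h4 : P * ub + Qc * wb + K < 0) : P * u + Qc * w + K < 0 := by
  have hP : P * u ≤ max (P * ua) (P * ub) := by
    rcases le_total 0 P with hP | hP
    · exact (mul_le_mul_of_nonneg_left hu.2 hP).trans (le_max_right _ _)
    · exact (mul_le_mul_of_nonpos_left hu.1 hP).trans (le_max_left _ _)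
  have hQ : Qc * w ≤ max (Qc * wa) (Qc * wb) := by
    rcases le_total 0 Qc with hQ | hQ
    · exact (mul_le_mul_of_nonneg_left hw.2 hQ).trans (le_max_right _ _)
    · exact (mul_le_mul_of_nonpos_left hw.1 hQ).trans (le_max_left _ _)
  rcases max_choice (P * ua) (P * ub) with ha | ha <;> rcases max_choice (Qc * wa) (Qc * wb) with hb | hb <;>
    rw [ha] at hP <;> rw [hb] at hQ <;> linarith

/-- **Corner value as rational data** (constancy rule on `W · u`): the value of `φ ∘ chart` at
`(u, C + W u + w)` for clock-affine `u, C, W` and a rational `w`. [folklore] -/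
def cornerValO (φ : LinFun) (e : ElemQ) (u C W w : Aff) : Option Aff :=
  (Aff.mulO W u).map fun p =>
    (Aff.smul (φ.F1 e) u).add ((Aff.smul (φ.Q e) p).add ((Aff.smul (φ.Q e) C).add ((Aff.smul (φ.Q e) w).add φ.g)))

/-- **Soundness of the corner value.** [folklore] -/
theorem eval_cornerValO {e : ElemQ} {u C W w A : Aff} (h : φ.cornerValO e u C W w = some A) (α : ℝ) :
    A.eval α = φ.eval α (e.chart (u.eval α) (C.eval α + W.eval α * u.eval α + w.eval α)) := by
  unfold cornerValO at h
  cases hm : Aff.mulO W u with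
  | none => rw [hm] at h; simp at h
  | some p =>
    rw [hm, Option.map_some, Option.some.injEq] at h
    subst h
    rw [φ.eval_chart, Aff.eval_add, Aff.eval_add, Aff.eval_add, Aff.eval_add, Aff.eval_smul, Aff.eval_smul, Aff.eval_smul,
      Aff.eval_smul, Aff.eval_of_mulO hm]
    ring

/-- Boolean test: an optional datum is defined and `≤ 0` at both endpoints. [folklore] -/
def leZeroB (a : Option Aff) : Bool :=
  match a with
  | some A => Aff.leB A (Aff.const 0)
  | none => false

/-- Boolean test: an optional datum is defined and `< 0` at both endpoints. [folklore] -/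
def ltZeroB (a : Option Aff) : Bool :=
  match a with
  | some A => Aff.ltB A (Aff.const 0)
  | none => false

/-- Soundness of `leZeroB`. [folklore] -/
theorem nonpos_of_leZeroB {a : Option Aff} (h : leZeroB a = true) {α : ℝ} (hα : α ∈ Icc (0 : ℝ) 1) :
    ∃ A, a = some A ∧ A.eval α ≤ 0 := by
  cases a with
  | none => simp [leZeroB] at h
  | some A =>
    refine ⟨A, rfl, ?_⟩
    have e := Aff.eval_le_eval h hα
    rwa [Aff.eval_const, Rat.cast_zero] at e

/-- Soundness of `ltZeroB`. [folklore] -/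
theorem neg_of_ltZeroB {a : Option Aff} (h : ltZeroB a = true) {α : ℝ} (hα : α ∈ Icc (0 : ℝ) 1) :
    ∃ A, a = some A ∧ A.eval α < 0 := by
  cases a with
  | none => simp [ltZeroB] at h
  | some A =>
    refine ⟨A, rfl, ?_⟩
    have e := Aff.eval_lt_eval h hα
    rwa [Aff.eval_const, Rat.cast_zero] at e

/-- **Piece test, weak**: `φ ∘ chart ≤ 0` at the four corners `u ∈ {ua, ub}`, `w ∈ {wa, wb}`. [folklore] -/
def pieceLeB (φ : LinFun) (e : ElemQ) (ua ub C W wa wb : Aff) : Bool :=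
  leZeroB (φ.cornerValO e ua C W wa) && leZeroB (φ.cornerValO e ua C W wb) &&
    leZeroB (φ.cornerValO e ub C W wa) && leZeroB (φ.cornerValO e ub C W wb)

/-- **Piece test, strict.** [folklore] -/
def pieceLtB (φ : LinFun) (e : ElemQ) (ua ub C W wa wb : Aff) : Bool :=
  ltZeroB (φ.cornerValO e ua C W wa) && ltZeroB (φ.cornerValO e ua C W wb) &&
    ltZeroB (φ.cornerValO e ub C W wa) && ltZeroB (φ.cornerValO e ub C W wb)

/-- **The corner principle, weak form**: four endpoint checks give `φ ≤ 0` on the whole piece, for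
every clock value in `[0,1]`. [folklore] -/
theorem le_on_piece {e : ElemQ} {ua ub C W wa wb : Aff} (h : φ.pieceLeB e ua ub C W wa wb = true)
    {α : ℝ} (hα : α ∈ Icc (0 : ℝ) 1) {u w : ℝ} (hu : u ∈ Icc (ua.eval α) (ub.eval α))
    (hw : w ∈ Icc (wa.eval α) (wb.eval α)) :
    φ.eval α (e.chart u (C.eval α + W.eval α * u + w)) ≤ 0 := by
  simp only [pieceLeB, Bool.and_eq_true] at h
  obtain ⟨⟨⟨h1, h2⟩, h3⟩, h4⟩ := h
  obtain ⟨A1, e1, v1⟩ := nonpos_of_leZeroB h1 hα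
  obtain ⟨A2, e2, v2⟩ := nonpos_of_leZeroB h2 hα
  obtain ⟨A3, e3, v3⟩ := nonpos_of_leZeroB h3 hα
  obtain ⟨A4, e4, v4⟩ := nonpos_of_leZeroB h4 hα
  rw [φ.eval_cornerValO e1, φ.eval_chart] at v1
  rw [φ.eval_cornerValO e2, φ.eval_chart] at v2
  rw [φ.eval_cornerValO e3, φ.eval_chart] at v3
  rw [φ.eval_cornerValO e4, φ.eval_chart] at v4
  rw [φ.eval_chart]
  have key := le_on_rect (P := (φ.F1 e : ℝ) + (φ.Q e : ℝ) * W.eval α) (Qc := (φ.Q e : ℝ))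
    (K := (φ.Q e : ℝ) * C.eval α + φ.g.eval α) hu hw (by linarith) (by linarith) (by linarith) (by linarith)
  linarith

/-- **The corner principle, strict form.** [folklore] -/
theorem lt_on_piece {e : ElemQ} {ua ub C W wa wb : Aff} (h : φ.pieceLtB e ua ub C W wa wb = true)
    {α : ℝ} (hα : α ∈ Icc (0 : ℝ) 1) {u w : ℝ} (hu : u ∈ Icc (ua.eval α) (ub.eval α))
    (hw : w ∈ Icc (wa.eval α) (wb.eval α)) :
    φ.eval α (e.chart u (C.eval α + W.eval α * u + w)) < 0 := by
  simp only [pieceLtB, Bool.and_eq_true] at h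
  obtain ⟨⟨⟨h1, h2⟩, h3⟩, h4⟩ := h
  obtain ⟨A1, e1, v1⟩ := neg_of_ltZeroB h1 hα
  obtain ⟨A2, e2, v2⟩ := neg_of_ltZeroB h2 hα
  obtain ⟨A3, e3, v3⟩ := neg_of_ltZeroB h3 hα
  obtain ⟨A4, e4, v4⟩ := neg_of_ltZeroB h4 hα
  rw [φ.eval_cornerValO e1, φ.eval_chart] at v1
  rw [φ.eval_cornerValO e2, φ.eval_chart] at v2
  rw [φ.eval_cornerValO e3, φ.eval_chart] at v3
  rw [φ.eval_cornerValO e4, φ.eval_chart] at v4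
  rw [φ.eval_chart]
  have key := lt_on_rect (P := (φ.F1 e : ℝ) + (φ.Q e : ℝ) * W.eval α) (Qc := (φ.Q e : ℝ))
    (K := (φ.Q e : ℝ) * C.eval α + φ.g.eval α) hu hw (by linarith) (by linarith) (by linarith) (by linarith)
  linarith

end LinFun

/-! ## Functionals on pieces -/

namespace ElemQ

variable (e : ElemQ)

/-- **Piece test for a functional, weak**: the slab data of the piece's regime are defined and, for
each slope bound `B` of the piece, the four corner values (with `w ∈ {δlo - r₀ B, δhi + r₀ B}`) are
`≤ 0`. [folklore] -/
def pieceFunLeB (e : ElemQ) (φ : LinFun) (π : PieceQ) (r0 : ℚ) : Bool :=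
  match e.slabCO π.reg, e.slabLoHiO π.reg π.ua π.ub with
  | some C, some (lo, hi) => (e.xiHis π.regXi).all fun B =>
      φ.pieceLeB e π.ua π.ub C (e.slabWA π.reg) (lo.sub (Aff.smul r0 B)) (hi.add (Aff.smul r0 B))
  | _, _ => false

/-- **Piece test for a functional, strict.** [folklore] -/
def pieceFunLtB (e : ElemQ) (φ : LinFun) (π : PieceQ) (r0 : ℚ) : Bool :=
  match e.slabCO π.reg, e.slabLoHiO π.reg π.ua π.ub with
  | some C, some (lo, hi) => (e.xiHis π.regXi).all fun B =>
      φ.pieceLtB e π.ua π.ub C (e.slabWA π.reg) (lo.sub (Aff.smul r0 B)) (hi.add (Aff.smul r0 B))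
  | _, _ => false

/-- **Regime tests of a piece**: the profile regime and the material-map regime. [folklore] -/
def pieceRegOKB (e : ElemQ) (π : PieceQ) : Bool := e.regOKB π.reg π.ua π.ub && e.xiRegOKB π.regXi π.ua π.ub

/-- **A functional checked on a valid piece is `≤ 0` at every band point whose abscissa lies in the
piece.** [folklore] -/
theorem le_of_pieceFunLeB (hv : e.validB = true) {φ : LinFun} {π : PieceQ} {r0 : ℚ} (hr : 0 ≤ r0)
    (h : e.pieceFunLeB φ π r0 = true) (hreg : e.pieceRegOKB π = true) {t₀ τ : ℝ} {p : ℝ × E²} (hp : p ∈ e.bandT t₀ τ r0)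
    (hu : e.uOf p.2 ∈ Icc (π.ua.eval (clock t₀ τ p.1)) (π.ub.eval (clock t₀ τ p.1))) :
    φ.eval (clock t₀ τ p.1) p.2 ≤ 0 := by
  set α := clock t₀ τ p.1 with hαdef
  have hα : α ∈ Icc (0 : ℝ) 1 := clock_mem_Icc t₀ τ p.1
  simp only [pieceRegOKB, Bool.and_eq_true] at hreg
  unfold pieceFunLeB at h
  cases hC : e.slabCO π.reg with
  | none => rw [hC] at h; exact absurd h (by simp)
  | some C =>
    cases hS : e.slabLoHiO π.reg π.ua π.ub with
    | none => rw [hC, hS] at h; exact absurd h (by simp)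
    | some lh =>
      obtain ⟨lo, hi⟩ := lh
      rw [hC, hS] at h
      have hregR := e.regOK_of_regOKB hreg.1 hα
      obtain ⟨B, hB, w, hw, hpt⟩ := e.band_chart_form hv hr hp hS hregR hreg.2 hu
      have key := φ.le_on_piece (List.all_eq_true.1 h B hB) hα hu hw
      rw [e.eval_slabCO hC, e.eval_slabWA] at key
      rw [hpt]; exact key

/-- **Strict version.** [folklore] -/
theorem lt_of_pieceFunLtB (hv : e.validB = true) {φ : LinFun} {π : PieceQ} {r0 : ℚ} (hr : 0 ≤ r0)
    (h : e.pieceFunLtB φ π r0 = true) (hreg : e.pieceRegOKB π = true) {t₀ τ : ℝ} {p : ℝ × E²} (hp : p ∈ e.bandT t₀ τ r0)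
    (hu : e.uOf p.2 ∈ Icc (π.ua.eval (clock t₀ τ p.1)) (π.ub.eval (clock t₀ τ p.1))) :
    φ.eval (clock t₀ τ p.1) p.2 < 0 := by
  set α := clock t₀ τ p.1 with hαdef
  have hα : α ∈ Icc (0 : ℝ) 1 := clock_mem_Icc t₀ τ p.1
  simp only [pieceRegOKB, Bool.and_eq_true] at hreg
  unfold pieceFunLtB at h
  cases hC : e.slabCO π.reg with
  | none => rw [hC] at h; exact absurd h (by simp)
  | some C =>
    cases hS : e.slabLoHiO π.reg π.ua π.ub with
    | none => rw [hC, hS] at h; exact absurd h (by simp)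
    | some lh =>
      obtain ⟨lo, hi⟩ := lh
      rw [hC, hS] at h
      have hregR := e.regOK_of_regOKB hreg.1 hα
      obtain ⟨B, hB, w, hw, hpt⟩ := e.band_chart_form hv hr hp hS hregR hreg.2 hu
      have key := φ.lt_on_piece (List.all_eq_true.1 h B hB) hα hu hw
      rw [e.eval_slabCO hC, e.eval_slabWA] at key
      rw [hpt]; exact key

end ElemQ

/-! ## Support edges, clips and coverage -/

namespace BoxQ

/-- **Edge functional** `q` of the support box (nonnegative inside): `0`: `z₀ - (a₀ + ρ/3)`,
`1`: `(b₀ - ρ/3) - z₀`, `2`: `z₁ - (a₁ + ρ/3)`, `3`: `(b₁ - ρ/3) - z₁`. [folklore] -/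
def edgeFun (B : BoxQ) (q : Fin 4) : LinFun :=
  if q = 0 then ⟨1, 0, Aff.smul (-1) (B.a₀.add (Aff.const (B.ρ / 3)))⟩
  else if q = 1 then ⟨-1, 0, B.b₀.sub (Aff.const (B.ρ / 3))⟩
  else if q = 2 then ⟨0, 1, Aff.smul (-1) (B.a₁.add (Aff.const (B.ρ / 3)))⟩
  else ⟨0, -1, B.b₁.sub (Aff.const (B.ρ / 3))⟩

/-- **Inside the support box every edge functional is nonnegative.** [folklore] -/
theorem edgeFun_nonneg (B : BoxQ) (q : Fin 4) {α : ℝ} {z : E²} (hz : z ∈ (B.frzAt α).supp) : 0 ≤ (B.edgeFun q).eval α z := by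
  obtain ⟨h1, h2, h3, h4⟩ := hz
  simp only [BoxQ.frzAt] at h1 h2 h3 h4
  fin_cases q <;>
  · simp [edgeFun, LinFun.eval, Aff.eval_smul, Aff.eval_add, Aff.eval_sub, Aff.eval_const]
    linarith

end BoxQ

namespace ElemQ

variable (e : ElemQ)

/-- The regime below the lower clip: `flat` for a run, gap `0` for a diagonal band. [folklore] -/
def regFirst : ElemQ → RegQ
  | run _ => .flat
  | dg _ => .gap 0

/-- The regime above the upper clip: `flat` for a run, the last gap for a diagonal band. [folklore] -/
def regLast : ElemQ → RegQ
  | run _ => .flat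
  | dg d => .gap d.T.kinks.length

/-- The slope of an edge functional along a slab, `F1 + Q · W`, as rational data. [folklore] -/
def slopeAff (e : ElemQ) (φ : LinFun) (reg : RegQ) : Aff := (Aff.const (φ.F1 e)).add (Aff.smul (φ.Q e) (e.slabWA reg))

/-- Its value. [folklore] -/
theorem eval_slopeAff (φ : LinFun) (reg : RegQ) (α : ℝ) :
    (e.slopeAff φ reg).eval α = (φ.F1 e : ℝ) + (φ.Q e : ℝ) * e.slabW reg α := by
  rw [slopeAff, Aff.eval_add, Aff.eval_const, Aff.eval_smul, e.eval_slabWA]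

/-- **Lower clip test**: the first regime reaches `uIn`, the edge functional `edgeIn` is `≤ 0` on
the slab at `u = uIn`, and its slope along the slab is positive. [folklore] -/
def clipInB (e : ElemQ) (ann : AnnQ) (B : BoxQ) (r0 : ℚ) : Bool :=
  e.regOKB e.regFirst ann.uIn ann.uIn &&
    e.pieceFunLeB (B.edgeFun ann.edgeIn) ⟨ann.uIn, ann.uIn, e.regFirst, [], 0⟩ r0 &&
    Aff.ltB (Aff.const 0) (e.slopeAff (B.edgeFun ann.edgeIn) e.regFirst)

/-- **Upper clip test.** [folklore] -/
def clipOutB (e : ElemQ) (ann : AnnQ) (B : BoxQ) (r0 : ℚ) : Bool :=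
  e.regOKB e.regLast ann.uOut ann.uOut &&
    e.pieceFunLeB (B.edgeFun ann.edgeOut) ⟨ann.uOut, ann.uOut, e.regLast, [], 0⟩ r0 &&
    Aff.ltB (e.slopeAff (B.edgeFun ann.edgeOut) e.regLast) (Aff.const 0)

/-- The first regime is valid on `[u, uIn]` for every `u` once it is valid at `uIn`. [folklore] -/
theorem regOK_regFirst {α uIn : ℝ} (h : e.RegOK e.regFirst α uIn uIn) (u : ℝ) : e.RegOK e.regFirst α u uIn := by
  cases e with
  | run r => trivial
  | dg d => exact ⟨fun k hk => by simp at hk, h.2⟩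

/-- The last regime is valid on `[uOut, u]` for every `u` once it is valid at `uOut`. [folklore] -/
theorem regOK_regLast {α uOut : ℝ} (h : e.RegOK e.regLast α uOut uOut) (u : ℝ) : e.RegOK e.regLast α uOut u := by
  cases e with
  | run r => trivial
  | dg d => exact ⟨h.1, fun k hk => by simp at hk⟩

/-- **Soundness of the lower clip**: a band point in the support box has abscissa `≥ uIn`. [folklore] -/
theorem uIn_le_uOf (hv : e.validB = true) {ann : AnnQ} {B : BoxQ} {r0 : ℚ} (hr : 0 ≤ r0) (h : e.clipInB ann B r0 = true)
    {t₀ τ : ℝ} {p : ℝ × E²} (hp : p ∈ e.bandT t₀ τ r0) (hz : p.2 ∈ (B.frzAt (clock t₀ τ p.1)).supp) :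
    ann.uIn.eval (clock t₀ τ p.1) ≤ e.uOf p.2 := by
  set α := clock t₀ τ p.1 with hαdef
  have hα : α ∈ Icc (0 : ℝ) 1 := clock_mem_Icc t₀ τ p.1
  simp only [clipInB, Bool.and_eq_true] at h
  obtain ⟨⟨hreg, hcor⟩, hslope⟩ := h
  by_contra hlt
  push Not at hlt
  set φ := B.edgeFun ann.edgeIn with hφ
  -- chart form on `[u, uIn]` in the first regime
  have hregR : e.RegOK e.regFirst α (e.uOf p.2) (ann.uIn.eval α) :=
    e.regOK_regFirst (e.regOK_of_regOKB hreg hα) _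
  -- at `u = uIn` the functional is `≤ 0` along the slab (the degenerate piece `[uIn, uIn]`)
  unfold pieceFunLeB at hcor
  cases hC : e.slabCO e.regFirst with
  | none => simp [hC] at hcor
  | some C =>
    cases hS : e.slabLoHiO e.regFirst ann.uIn ann.uIn with
    | none => simp [hC, hS] at hcor
    | some lh =>
      obtain ⟨lo, hi⟩ := lh
      simp only [hC, hS] at hcor
      -- the slab add-ons of the first regime do not depend on the piece: reuse them on `[u, uIn]`
      have hS' : e.slabLoHiO e.regFirst ann.uIn ann.uIn = some (lo, hi) → ∀ (ua : Aff), e.slabLoHiO e.regFirst ua ann.uIn = some (lo, hi) := by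
        intro h0 ua
        cases e with
        | run r => simpa [slabLoHiO, regFirst] using h0
        | dg d => simpa [slabLoHiO, regFirst] using h0
      -- chart form with `ua := u` itself (as the constant datum)
      have hreg2 : e.RegOK e.regFirst α ((Aff.const 0).eval α + e.uOf p.2) (ann.uIn.eval α) := by
        rw [Aff.eval_const, Rat.cast_zero, zero_add]; exact hregR
      obtain ⟨w, hw, hpt⟩ : ∃ w : ℝ, w ∈ Icc (lo.eval α - r0 * e.whi) (hi.eval α + r0 * e.whi) ∧
          p.2 = e.chart (e.uOf p.2) (e.slabC e.regFirst α + e.slabW e.regFirst α * e.uOf p.2 + w) := by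
        -- the line is in the slab on `[uOf, uIn]`: argue directly with `line_sub_mem` in the gap / flat regime
        refine ⟨e.vOf p.2 - (e.slabC e.regFirst α + e.slabW e.regFirst α * e.uOf p.2), ?_, ?_⟩
        · have h1' := abs_le.1 ((e.mem_bandT_iff t₀ τ r0 p).1 hp)
          have hdu : (r0 : ℝ) * e.xi.du α (e.uOf p.2) ≤ r0 * e.whi := by
            exact mul_le_mul_of_nonneg_left (e.du_le_whi hv hα _) (by exact_mod_cast hr)
          have h1 : -(↑r0 * ↑e.whi) ≤ e.vOf p.2 - e.line α (e.uOf p.2) ∧ e.vOf p.2 - e.line α (e.uOf p.2) ≤ r0 * e.whi :=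
            ⟨by linarith [h1'.1], h1'.2.trans hdu⟩
          have h2 : e.line α (e.uOf p.2) - (e.slabC e.regFirst α + e.slabW e.regFirst α * e.uOf p.2) ∈ Icc (lo.eval α) (hi.eval α) := by
            cases e with
            | run r =>
              simp only [slabLoHiO, Option.some.injEq, Prod.mk.injEq] at hS
              obtain ⟨rfl, rfl⟩ := hS
              simp [line, slabC, slabW]
            | dg d =>
              simp only [slabLoHiO, regFirst, Option.some.injEq, Prod.mk.injEq] at hS
              obtain ⟨rfl, rfl⟩ := hS
              have hT : d.T.LenPos := DgQ.lenPosT_of_validB hv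
              have hin := d.T.inGap_of_regOK hregR (u := (dg d).uOf p.2) ⟨le_rfl, hlt.le⟩
              simp only [line, slabC, slabW, regFirst]
              rw [d.T.val_eq_gapVal hT hin, d.T.gapVal_eq]; simp
          constructor <;> linarith [h1.1, h1.2, h2.1, h2.2]
        · have e3 : e.slabC e.regFirst α + e.slabW e.regFirst α * e.uOf p.2 +
              (e.vOf p.2 - (e.slabC e.regFirst α + e.slabW e.regFirst α * e.uOf p.2)) = e.vOf p.2 := by ring
          rw [e3, e.chart_uOf_vOf]
      have hw' : w ∈ Icc ((lo.sub (Aff.smul r0 (Aff.const e.whi))).eval α) ((hi.add (Aff.smul r0 (Aff.const e.whi))).eval α) := by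
        rw [Aff.eval_sub, Aff.eval_add, Aff.eval_smul, Aff.eval_const]; exact hw
      have hIn : ann.uIn.eval α ∈ Icc (ann.uIn.eval α) (ann.uIn.eval α) := ⟨le_rfl, le_rfl⟩
      have hcor' : φ.pieceLeB e ann.uIn ann.uIn C (e.slabWA e.regFirst) (lo.sub (Aff.smul r0 (Aff.const e.whi)))
          (hi.add (Aff.smul r0 (Aff.const e.whi))) = true := by simpa [xiHis] using hcor
      have key := φ.le_on_piece hcor' hα hIn hw'
      rw [e.eval_slabCO hC, e.eval_slabWA, φ.eval_chart] at key
      -- positive slope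
      have hP := Aff.eval_lt_eval hslope hα
      rw [Aff.eval_const, Rat.cast_zero, e.eval_slopeAff] at hP
      -- the value at `p.2` is negative, contradicting membership in the support box
      have hval : φ.eval α p.2 < 0 := by
        rw [hpt, φ.eval_chart]
        nlinarith
      exact absurd (B.edgeFun_nonneg ann.edgeIn hz) (not_le.2 hval)

/-- **Soundness of the upper clip**: a band point in the support box has abscissa `≤ uOut`. [folklore] -/
theorem uOf_le_uOut (hv : e.validB = true) {ann : AnnQ} {B : BoxQ} {r0 : ℚ} (hr : 0 ≤ r0) (h : e.clipOutB ann B r0 = true)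
    {t₀ τ : ℝ} {p : ℝ × E²} (hp : p ∈ e.bandT t₀ τ r0) (hz : p.2 ∈ (B.frzAt (clock t₀ τ p.1)).supp) :
    e.uOf p.2 ≤ ann.uOut.eval (clock t₀ τ p.1) := by
  set α := clock t₀ τ p.1 with hαdef
  have hα : α ∈ Icc (0 : ℝ) 1 := clock_mem_Icc t₀ τ p.1
  simp only [clipOutB, Bool.and_eq_true] at h
  obtain ⟨⟨hreg, hcor⟩, hslope⟩ := h
  by_contra hlt
  push Not at hlt
  set φ := B.edgeFun ann.edgeOut with hφ
  have hregR : e.RegOK e.regLast α (ann.uOut.eval α) (e.uOf p.2) :=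
    e.regOK_regLast (e.regOK_of_regOKB hreg hα) _
  unfold pieceFunLeB at hcor
  cases hC : e.slabCO e.regLast with
  | none => simp [hC] at hcor
  | some C =>
    cases hS : e.slabLoHiO e.regLast ann.uOut ann.uOut with
    | none => simp [hC, hS] at hcor
    | some lh =>
      obtain ⟨lo, hi⟩ := lh
      simp only [hC, hS] at hcor
      obtain ⟨w, hw, hpt⟩ : ∃ w : ℝ, w ∈ Icc (lo.eval α - r0 * e.whi) (hi.eval α + r0 * e.whi) ∧
          p.2 = e.chart (e.uOf p.2) (e.slabC e.regLast α + e.slabW e.regLast α * e.uOf p.2 + w) := by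
        refine ⟨e.vOf p.2 - (e.slabC e.regLast α + e.slabW e.regLast α * e.uOf p.2), ?_, ?_⟩
        · have h1' := abs_le.1 ((e.mem_bandT_iff t₀ τ r0 p).1 hp)
          have hdu : (r0 : ℝ) * e.xi.du α (e.uOf p.2) ≤ r0 * e.whi := by
            exact mul_le_mul_of_nonneg_left (e.du_le_whi hv hα _) (by exact_mod_cast hr)
          have h1 : -(↑r0 * ↑e.whi) ≤ e.vOf p.2 - e.line α (e.uOf p.2) ∧ e.vOf p.2 - e.line α (e.uOf p.2) ≤ r0 * e.whi :=
            ⟨by linarith [h1'.1], h1'.2.trans hdu⟩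
          have h2 : e.line α (e.uOf p.2) - (e.slabC e.regLast α + e.slabW e.regLast α * e.uOf p.2) ∈ Icc (lo.eval α) (hi.eval α) := by
            cases e with
            | run r =>
              simp only [slabLoHiO, Option.some.injEq, Prod.mk.injEq] at hS
              obtain ⟨rfl, rfl⟩ := hS
              simp [line, slabC, slabW]
            | dg d =>
              simp only [slabLoHiO, regLast, Option.some.injEq, Prod.mk.injEq] at hS
              obtain ⟨rfl, rfl⟩ := hS
              have hT : d.T.LenPos := DgQ.lenPosT_of_validB hv
              have hin := d.T.inGap_of_regOK hregR (u := (dg d).uOf p.2) ⟨hlt.le, le_rfl⟩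
              simp only [line, slabC, slabW, regLast]
              rw [d.T.val_eq_gapVal hT hin, d.T.gapVal_eq]; simp
          constructor <;> linarith [h1.1, h1.2, h2.1, h2.2]
        · have e3 : e.slabC e.regLast α + e.slabW e.regLast α * e.uOf p.2 +
              (e.vOf p.2 - (e.slabC e.regLast α + e.slabW e.regLast α * e.uOf p.2)) = e.vOf p.2 := by ring
          rw [e3, e.chart_uOf_vOf]
      have hw' : w ∈ Icc ((lo.sub (Aff.smul r0 (Aff.const e.whi))).eval α) ((hi.add (Aff.smul r0 (Aff.const e.whi))).eval α) := by
        rw [Aff.eval_sub, Aff.eval_add, Aff.eval_smul, Aff.eval_const]; exact hw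
      have hOut : ann.uOut.eval α ∈ Icc (ann.uOut.eval α) (ann.uOut.eval α) := ⟨le_rfl, le_rfl⟩
      have hcor' : φ.pieceLeB e ann.uOut ann.uOut C (e.slabWA e.regLast) (lo.sub (Aff.smul r0 (Aff.const e.whi)))
          (hi.add (Aff.smul r0 (Aff.const e.whi))) = true := by simpa [xiHis] using hcor
      have key := φ.le_on_piece hcor' hα hOut hw'
      rw [e.eval_slabCO hC, e.eval_slabWA, φ.eval_chart] at key
      have hP := Aff.eval_lt_eval hslope hα
      rw [Aff.eval_const, Rat.cast_zero, e.eval_slopeAff] at hP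
      have hval : φ.eval α p.2 < 0 := by
        rw [hpt, φ.eval_chart]
        nlinarith
      exact absurd (B.edgeFun_nonneg ann.edgeOut hz) (not_le.2 hval)

/-- **Chain test of the pieces**: consecutive intervals overlap or abut, the last one reaches `uOut`. [folklore] -/
def chainB (uOut : Aff) : PieceQ → List PieceQ → Bool
  | π, [] => Aff.leB uOut π.ub
  | π, π' :: rest => Aff.leB π'.ua π.ub && chainB uOut π' rest

/-- **Coverage test**: the pieces cover `[uIn, uOut]` and every piece has a valid regime. [folklore] -/
def coverB (e : ElemQ) (ann : AnnQ) : Bool :=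
  (ann.pieces.all fun π => e.pieceRegOKB π) &&
    match ann.pieces with
    | [] => false
    | π :: rest => Aff.leB π.ua ann.uIn && chainB ann.uOut π rest

/-- Soundness of the chain test. [folklore] -/
theorem exists_of_chainB {uOut : Aff} {α : ℝ} (hα : α ∈ Icc (0 : ℝ) 1) :
    ∀ (π : PieceQ) (rest : List PieceQ), chainB uOut π rest = true → ∀ {u : ℝ}, π.ua.eval α ≤ u → u ≤ uOut.eval α →
      ∃ π' ∈ π :: rest, u ∈ Icc (π'.ua.eval α) (π'.ub.eval α)
  | π, [], h, u, hlo, hhi => by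
    simp only [chainB] at h
    exact ⟨π, by simp, hlo, hhi.trans (Aff.eval_le_eval h hα)⟩
  | π, π' :: rest, h, u, hlo, hhi => by
    simp only [chainB, Bool.and_eq_true] at h
    by_cases hub : u ≤ π.ub.eval α
    · exact ⟨π, by simp, hlo, hub⟩
    · push Not at hub
      have hlo' : π'.ua.eval α ≤ u := (Aff.eval_le_eval h.1 hα).trans hub.le
      obtain ⟨π'', hmem, hu⟩ := exists_of_chainB hα π' rest h.2 hlo' hhi
      exact ⟨π'', List.mem_cons_of_mem _ hmem, hu⟩

/-- **Soundness of the coverage test**: every abscissa in `[uIn, uOut]` lies in a piece with a valid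
regime. [folklore] -/
theorem exists_piece_of_coverB {ann : AnnQ} (h : e.coverB ann = true) {α : ℝ} (hα : α ∈ Icc (0 : ℝ) 1) {u : ℝ}
    (hu : u ∈ Icc (ann.uIn.eval α) (ann.uOut.eval α)) :
    ∃ π ∈ ann.pieces, u ∈ Icc (π.ua.eval α) (π.ub.eval α) ∧ e.pieceRegOKB π = true := by
  simp only [coverB, Bool.and_eq_true, List.all_eq_true] at h
  obtain ⟨hregs, hchain⟩ := h
  cases hp : ann.pieces with
  | nil => rw [hp] at hchain; exact absurd hchain (by simp)
  | cons π rest =>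
    rw [hp] at hchain
    simp only [Bool.and_eq_true] at hchain
    obtain ⟨π', hmem, hu'⟩ := exists_of_chainB hα π rest hchain.2 ((Aff.eval_le_eval hchain.1 hα).trans hu.1) hu.2
    refine ⟨π', hmem, hu', hregs π' ?_⟩
    rw [hp]; exact hmem

/-- **All piece tests of an element**: both clips and the coverage. [folklore] -/
def piecesOKB (e : ElemQ) (ann : AnnQ) (B : BoxQ) (r0 : ℚ) : Bool :=
  e.clipInB ann B r0 && e.clipOutB ann B r0 && e.coverB ann && decide (0 ≤ r0)

/-- The radius is nonnegative when the piece tests pass. [folklore] -/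
theorem r0_nonneg_of_piecesOKB {ann : AnnQ} {B : BoxQ} {r0 : ℚ} (h : e.piecesOKB ann B r0 = true) : 0 ≤ r0 := by
  simp only [piecesOKB, Bool.and_eq_true, decide_eq_true_eq] at h; exact h.2

/-- **Main theorem of the file**: every band point of a valid element inside its support box lies
in one of the certified pieces (abscissa in the piece's interval, valid regime). [folklore] -/
theorem exists_piece (hv : e.validB = true) {ann : AnnQ} {B : BoxQ} {r0 : ℚ} (h : e.piecesOKB ann B r0 = true)
    {t₀ τ : ℝ} {p : ℝ × E²} (hp : p ∈ e.bandT t₀ τ r0) (hz : p.2 ∈ (B.frzAt (clock t₀ τ p.1)).supp) :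
    ∃ π ∈ ann.pieces, e.uOf p.2 ∈ Icc (π.ua.eval (clock t₀ τ p.1)) (π.ub.eval (clock t₀ τ p.1)) ∧
      e.pieceRegOKB π = true := by
  have hr := e.r0_nonneg_of_piecesOKB h
  simp only [piecesOKB, Bool.and_eq_true] at h
  obtain ⟨⟨⟨hin, hout⟩, hcov⟩, _⟩ := h
  exact e.exists_piece_of_coverB hcov (clock_mem_Icc t₀ τ p.1) ⟨e.uIn_le_uOf hv hr hin hp hz, e.uOf_le_uOut hv hr hout hp hz⟩

/-- **Functionals checked on all pieces of a given tag set are `≤ 0` on the corresponding band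
points**: if `φ` passes the weak piece test on every piece whose tag satisfies `P`, then `φ ≤ 0` at
every band point in the support box whose piece has such a tag — stated with the piece exposed.
[folklore] -/
theorem le_of_tagged (hv : e.validB = true) {ann : AnnQ} {B : BoxQ} {r0 : ℚ} (h : e.piecesOKB ann B r0 = true)
    {φ : LinFun} {Ptag : ℕ → Bool} (hφ : ∀ π ∈ ann.pieces, Ptag π.tag = true → e.pieceFunLeB φ π r0 = true)
    {t₀ τ : ℝ} {p : ℝ × E²} (hp : p ∈ e.bandT t₀ τ r0) (hz : p.2 ∈ (B.frzAt (clock t₀ τ p.1)).supp) :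
    ∃ π ∈ ann.pieces, e.uOf p.2 ∈ Icc (π.ua.eval (clock t₀ τ p.1)) (π.ub.eval (clock t₀ τ p.1)) ∧
      (Ptag π.tag = true → φ.eval (clock t₀ τ p.1) p.2 ≤ 0) := by
  obtain ⟨π, hmem, hu, hreg⟩ := e.exists_piece hv h hp hz
  exact ⟨π, hmem, hu, fun ht => e.le_of_pieceFunLeB hv (e.r0_nonneg_of_piecesOKB h) (hφ π hmem ht) hreg hp hu⟩

end ElemQ

end PlanarKinematics

end Literature.Analysis.FluidPDE
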